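import Summits.QuantumFields.YangMills.Theses.ParabolicTrajectory
import Literature.MathematicalPhysics.QuantumFieldTheory.LatticeGaugeProofs

/-!
# `LatticeGapOnTrajectory` — negative-side support III: blow-up renormalisations empty the transfer fibre

Support file for crux `stmt-QuantumFields-10523` (`ParabolicTrajectory.LatticeGapOnTrajectory`, (B)), extracted
from the standing disprover's work file `Cruxes/LatticeGapOnTrajectory/Disproof.lean` §4. Tree objects only.

* `exists_bump_test`: a nonnegative real Schwartz function on `ℝ⁴` equal to `1` at the origin (`ContDiffBump`).
* `exists_renorm_not_isYangMillsFor`: for every scheme `sch` there is a scheme with the SAME `(a, β, L)` (species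
  renormalisation `c_s(k) = k · a_k⁻⁴`, `m = 0`) along which NO OS datum satisfies `IsYangMillsFor`: the degree-one
  lattice Schwinger function of the constant observable against the bump is `k · ∑_{x ∈ Λ_k} f(a_k x) ≥ k`.
  Together with the vacuum inhabitant at `c = m = 0` this shows that the `∀ sch'` of (B)'s transfer clause ranges
  over witness data that can trivialise or EMPTY a fibre but never manufacture a limit.
-/

namespace Summit.QuantumFields.YangMills.Theorems.LatticeGapOnTrajectory.Negative

open Filter Topology MeasureTheory
open Literature.MathematicalPhysics.QuantumFieldTheory Literature.MathematicalPhysics.QuantumLattice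

noncomputable section

variable {G : Type} [Group G] [TopologicalSpace G] [IsTopologicalGroup G] [CompactSpace G]
  [MeasurableSpace G] [BorelSpace G]

omit [Group G] [TopologicalSpace G] [IsTopologicalGroup G] [CompactSpace G] [MeasurableSpace G] [BorelSpace G] in
/-- A nonnegative real test function on `ℝ⁴` equal to `1` at the origin (a smooth bump). [folklore] -/
theorem exists_bump_test :
    ∃ f : SchwartzMap (EuclideanSpace ℝ (Fin 4)) ℝ, (∀ x, 0 ≤ f x) ∧ f 0 = 1 := by
  let χ : ContDiffBump (0 : EuclideanSpace ℝ (Fin 4)) := ⟨1, 2, one_pos, one_lt_two⟩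
  refine ⟨χ.hasCompactSupport.toSchwartzMap χ.contDiff, fun x => χ.nonneg, ?_⟩
  show (χ : EuclideanSpace ℝ (Fin 4) → ℝ) 0 = 1
  exact χ.one_of_mem_closedBall (Metric.mem_closedBall_self (le_of_lt χ.rIn_pos))

/-- **Blow-up renormalisations EMPTY the transfer fibre.** For every scheme there is a species renormalisation with
the same `(a, β, L)` along which NO OS datum is a continuum limit (`IsYangMillsFor` fails for every `T`): with
`c_s(k) = k · a_k⁻⁴`, `m = 0`, the degree-one lattice Schwinger function of the constant observable `1` against a
bump test function equals `k · ∑_{x ∈ Λ_k} f(a_k x) ≥ k`, an unbounded sequence. [folklore] -/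
theorem exists_renorm_not_isYangMillsFor (r : LatticeRep G) (sch : SpeciesScheme (YMSpecies G)) :
    ∃ sch' : SpeciesScheme (YMSpecies G), sch'.a = sch.a ∧ sch'.β = sch.β ∧ sch'.L = sch.L ∧
      ∀ T : OSData (YMSpecies G) 4, ¬ IsYangMillsFor r sch' T := by
  -- the constant observable and the blow-up scheme, as anonymous structures
  let one : YMSpecies G :=
    { F := fun _ => 1, supp := ∅, isCylinder := fun _ _ _ => rfl, gaugeInvariant := fun _ _ => rfl,
      bounded := ⟨1, fun _ => by simp⟩, measurable := measurable_const }
  let sch' : SpeciesScheme (YMSpecies G) :=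
    { a := sch.a, a_pos := sch.a_pos, tendsto_a := sch.tendsto_a, β := sch.β, L := sch.L,
      tendsto_L := sch.tendsto_L, c := fun _ k => (k : ℝ) * ((sch.a k) ^ 4)⁻¹, m := fun _ _ => 0 }
  refine ⟨sch', rfl, rfl, rfl, fun T hT => ?_⟩
  obtain ⟨f, hf0, hf1⟩ := exists_bump_test
  -- the degree-one lattice Schwinger function is the deterministic number k · Σ f(a_k x)
  have hval : ∀ k : ℕ, latticeSchwinger r.ρ sch' (fun s => s.F) k 1 (fun _ => one) (fun _ => f) =
      (k : ℝ) * ∑ x ∈ Literature.Probability.LatticeModels.box 4 (sch.L k), f (sch.a k • siteToE x) := by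
    intro k
    haveI := isProbabilityMeasure_wilsonMeasure (d := 4) (L := sch'.side k) r.ρ r.continuous (sch'.β k)
    have hU : ∀ U : LGConfig 4 G, smearedLatticeField one.F
        (Literature.Probability.LatticeModels.box 4 (sch'.L k)) (sch'.a k) (sch'.c one k) (sch'.m one k) f U =
          (k : ℝ) * ∑ x ∈ Literature.Probability.LatticeModels.box 4 (sch.L k), f (sch.a k • siteToE x) := by
      intro U
      have ha : (sch.a k) ^ 4 ≠ 0 := pow_ne_zero 4 (sch.a_pos k).ne'
      simp only [smearedLatticeField, one, sch', sub_zero, mul_one]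
      rw [mul_assoc (k : ℝ), inv_mul_cancel₀ ha, mul_one]
    simp only [latticeSchwinger, Finset.univ_unique, Finset.prod_singleton, hU, integral_const, smul_eq_mul,
      probReal_univ, one_mul]
  have hge : ∀ k : ℕ, (k : ℝ) ≤ latticeSchwinger r.ρ sch' (fun s => s.F) k 1 (fun _ => one) (fun _ => f) := by
    intro k
    rw [hval]
    have hsum : 1 ≤ ∑ x ∈ Literature.Probability.LatticeModels.box 4 (sch.L k), f (sch.a k • siteToE x) := by
      have h0 : f (sch.a k • siteToE (0 : Literature.Probability.LatticeModels.Site 4)) = 1 := by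
        have : siteToE (0 : Literature.Probability.LatticeModels.Site 4) = 0 := by
          ext i; simp [siteToE_apply]
        rw [this, smul_zero, hf1]
      calc (1 : ℝ) = f (sch.a k • siteToE (0 : Literature.Probability.LatticeModels.Site 4)) := h0.symm
        _ ≤ ∑ x ∈ Literature.Probability.LatticeModels.box 4 (sch.L k), f (sch.a k • siteToE x) :=
          Finset.single_le_sum (f := fun x => f (sch.a k • siteToE x)) (fun x _ => hf0 _)
            (Literature.Probability.LatticeModels.zero_mem_box 4 (sch.L k))
    calc (k : ℝ) = k * 1 := (mul_one _).symm
      _ ≤ k * ∑ x ∈ Literature.Probability.LatticeModels.box 4 (sch.L k), f (sch.a k • siteToE x) :=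
        mul_le_mul_of_nonneg_left hsum (Nat.cast_nonneg k)
  have hoff : Literature.MathematicalPhysics.AQFT.IsOffDiagonal
      (SchwartzMap.tensorFin 1 fun _ : Fin 1 => ofRealTest f) := by
    intro x hx
    obtain ⟨i, j, hij, -⟩ := hx
    exact absurd (Subsingleton.elim i j) hij
  have h := hT 1 one_ne_zero (fun _ => one) (fun _ => f) _ (isTensorOf_tensorFin _) hoff
  have hnorm : ∀ k : ℕ, ‖((latticeSchwinger r.ρ sch' (fun s => s.F) k 1 (fun _ => one) (fun _ => f) : ℝ) : ℂ)‖
      = latticeSchwinger r.ρ sch' (fun s => s.F) k 1 (fun _ => one) (fun _ => f) := fun k => by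
    rw [Complex.norm_real, Real.norm_of_nonneg ((Nat.cast_nonneg k).trans (hge k))]
  have hev₁ := h.norm.eventually_lt_const (lt_add_one _)
  have hev₂ : ∀ᶠ k : ℕ in atTop, ‖T.schwinger 1 (fun _ => one)
      (SchwartzMap.tensorFin 1 fun _ : Fin 1 => ofRealTest f)‖ + 1 < (k : ℝ) :=
    tendsto_natCast_atTop_atTop.eventually_gt_atTop _
  obtain ⟨k, hk₁, hk₂⟩ := (hev₁.and hev₂).exists
  rw [hnorm] at hk₁
  have := hge k
  linarith

end

end Summit.QuantumFields.YangMills.Theorems.LatticeGapOnTrajectory.Negative
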